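import Summits.KontsevichZagierPeriods.KontsevichZagierPeriods.Theses.SymplecticScissors
import Summits.KontsevichZagierPeriods.KontsevichZagierPeriods.Theses.LowDimension
import Summits.KontsevichZagierPeriods.KontsevichZagierPeriods.Theses.HodgeLevel
import Summits.KontsevichZagierPeriods.KontsevichZagierPeriods.Theorems.RealOnePeriodRelations.Negative.Kit
import Literature.NumberTheory.Transcendental.KZCalculusProofs
import Literature.NumberTheory.Transcendental.KZGroundingRelations
import Literature.NumberTheory.Transcendental.SemialgebraicMapsProofs

/-!
# `PlanarAreas` (stmt-KontsevichZagierPeriods-4990, routes SymplecticScissors r5 / LowDimension r3 /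
# HodgeLevel r4) — line `green-native-bands` (lead skeleton, v3)

The crux: two integrand-`1` planar representations (`ℚ`-semialgebraic planar sets of finite area) of
equal area are KZ-equivalent (full calculus, chains through any dimension).

Line (crux idea card `Cruxes/PlanarAreas/Ideas/green-native-bands.md`): in the FULL calculus the typed
Green generator of the sibling crux `RealOnePeriodRelations` (stmt-10042; `greenSet` of
`Theorems/RealOnePeriodRelations/Negative/Kit.lean`) is a chain of moves on the native band `Δ`:
rule 3 along `b` with the coefficient `A` as its own primitive, the coordinate swap (rule 2), rule 3
along `a` with primitive `B`, the common bulk being `[Δ, h]` with `h = ∂_b A = ∂_a B` a.e.; together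
with AREA SLICING (an integrand-`1` planar representation is, modulo relations, a `ℤ`-combination of
1-dimensional representations: cylindrical decomposition, rule 1a, rule 3 with primitive `y`) this
gives `RealOnePeriodRelations → PlanarAreas` (`PlanarAreas_of`, sorry-free below).

Reshape by the lead (v1, 2026-08-16): every stub targets `KZ.relations` (what the crux needs) rather
than `KZ.relationsLE 2`; the Green bulk is cut into four analytic stubs (fibre-derivative
semialgebraicity, a.e. symmetry of mixed partials, integrability of `∂_b A`, and the engine = rule 3 on
a band with a null exceptional set) plus the coordinate swap; `stub_greenInRelations` is held by the
lead and becomes sorry-free glue over those stubs at the next reshape.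

References: M. Kontsevich, D. Zagier, *Periods* (2001), §1.2 (rules (1)–(3)); S. Basu, R. Pollack,
M.-F. Roy, *Algorithms in Real Algebraic Geometry* (2006), Cor. 5.7, Prop. 3.22; A. Huber,
G. Wüstholz, *Transcendence and Linear Relations of 1-Periods* (2022), Thm 13.3 (2) (enters only
through stmt-10042).
-/

noncomputable section

open scoped BigOperators
open Set MeasureTheory
open Literature.NumberTheory.Transcendental
open Literature.ModelTheory.ExponentialFields (IsSemialgebraic)
open Summit.KontsevichZagierPeriods.SymplecticScissors.RealOnePeriodRelationsNegative (greenSet M₁ H₁ crux_iff)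

namespace Summit.KontsevichZagierPeriods.SymplecticScissors.PlanarAreas

/-! ## Stubs -/

/-- **Area slicing.** An integrand-`1` planar representation is, modulo `KZ.relations`, a
`ℤ`-combination of 1-dimensional representations: cut along the cylinders of a `ℚ`-cylindrical
decomposition adapted to the domain (rule 1a), discard null cells, and go down each inner band by
Newton–Leibniz with primitive `y` (rule 3) — steps 1–3 of `KZ.of_sub_of_mem_relations_cell` /
`KZ.of_sub_of_mem_relations_groundLast` (KZGroundingRelations.lean). [size M] -/
theorem stub_areaSlicing : ∀ r : KZ.IntegralRep 2, (∀ p ∈ r.domain, r.integrand p = 1) →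
    ∃ c ∈ AddSubgroup.closure (Set.range fun s : KZ.IntegralRep 1 => KZ.of s),
      KZ.of r - c ∈ KZ.relations := by
  sorry

/-- **The engine: Newton–Leibniz down a band, off a null exceptional set.** For a closed band
`{a₀ ≤ x ≤ a₁, α x ≤ y ≤ β x}` (rational `a₀ < a₁`, `ℚ`-semialgebraic `α ≤ β` on `(a₀, a₁)`), a
`ℚ`-semialgebraic BOUNDED `F` on the band, continuous on every closed fibre and with `∂F/∂y = r.integrand` at
every point of the open fibres outside a `ℚ`-semialgebraic null set `Z`, the representation `r` on
the band differs by relations from the base representation `[∫_{(a₀,a₁)} F(x, β x) − F(x, α x) dx]`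
(which exists): cylindrical decomposition adapted to `Z` and the band, one `newtonLeibnizRel` instance
per sub-band, telescoping by rule 1b, null pieces by rule 1a. [size L] -/
theorem stub_bandNewtonLeibniz : ∀ (a₀ a₁ : ℚ) (α β : ℝ → ℝ) (F : (Fin 2 → ℝ) → ℝ)
    (Z : Set (Fin 2 → ℝ)) (r : KZ.IntegralRep 2), a₀ < a₁ →
    IsSemialgebraicFunOn ℚ {z : Fin 1 → ℝ | z 0 ∈ Set.Ioo (a₀ : ℝ) a₁} (fun z => α (z 0)) →
    IsSemialgebraicFunOn ℚ {z : Fin 1 → ℝ | z 0 ∈ Set.Ioo (a₀ : ℝ) a₁} (fun z => β (z 0)) →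
    (∀ t ∈ Set.Ioo (a₀ : ℝ) a₁, α t ≤ β t) →
    r.domain = {p : Fin 2 → ℝ | p 0 ∈ Set.Icc (a₀ : ℝ) a₁ ∧ α (p 0) ≤ p 1 ∧ p 1 ≤ β (p 0)} →
    IsSemialgebraicFunOn ℚ r.domain F → (∃ M : ℝ, ∀ p ∈ r.domain, |F p| ≤ M) →
    (∀ t ∈ Set.Ioo (a₀ : ℝ) a₁, ContinuousOn (fun s : ℝ => F ![t, s]) (Set.Icc (α t) (β t))) →
    IsSemialgebraic ℚ Z → volume Z = 0 →
    (∀ p ∈ r.domain, p 0 ∈ Set.Ioo (a₀ : ℝ) a₁ → α (p 0) < p 1 → p 1 < β (p 0) → p ∉ Z →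
      HasDerivAt (fun s : ℝ => F ![p 0, s]) (r.integrand p) (p 1)) →
    ∃ r' : KZ.IntegralRep 1, r'.domain = {z : Fin 1 → ℝ | z 0 ∈ Set.Ioo (a₀ : ℝ) a₁} ∧
      (∀ z ∈ r'.domain, r'.integrand z = F ![z 0, β (z 0)] - F ![z 0, α (z 0)]) ∧
      KZ.of r - KZ.of r' ∈ KZ.relations := by
  sorry

/-- **The coordinate swap is a move** (rule 2 with the permutation matrix, `|det| = 1`), for an
arbitrary planar representation: `[σ, f] ≡ [swap⁻¹ σ, f ∘ swap]`. [size S] -/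
theorem stub_swap : ∀ r : KZ.IntegralRep 2, ∃ r' : KZ.IntegralRep 2,
    r'.domain = {q : Fin 2 → ℝ | ![q 1, q 0] ∈ r.domain} ∧
    (∀ q ∈ r'.domain, r'.integrand q = r.integrand ![q 1, q 0]) ∧
    KZ.of r - KZ.of r' ∈ KZ.relations := by
  sorry

/-- **Fibre derivatives of a semialgebraic function are semialgebraic** (Basu–Pollack–Roy Prop. 3.22
and the remark on partial derivatives, via the formula kit of SemialgebraicDerivativeProofs.lean —
`sa_exists/sa_forall/sa_graph₂/hasDerivAt_iff_forall_mem`): for `F` `ℚ`-semialgebraic on the closed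
triangle `Δ`, the vertical fibre derivative (Mathlib's `deriv`, which is `0` where the fibre function
is not differentiable), extended by `0` off the open triangle, is a `ℚ`-semialgebraic function on
`Δ`. [size M/L] -/
theorem stub_fibreDerivSemialgebraic : ∀ F : (Fin 2 → ℝ) → ℝ,
    IsSemialgebraicFunOn ℚ {p : Fin 2 → ℝ | 0 ≤ p 0 ∧ 0 ≤ p 1 ∧ p 0 + p 1 ≤ 1} F →
    IsSemialgebraicFunOn ℚ {p : Fin 2 → ℝ | 0 ≤ p 0 ∧ 0 ≤ p 1 ∧ p 0 + p 1 ≤ 1}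
      (fun p => if 0 < p 0 ∧ 0 < p 1 ∧ p 0 + p 1 < 1
        then deriv (fun s : ℝ => F ![p 0, s]) (p 1) else 0) := by
  sorry

/-- **Mixed partials agree almost everywhere.** For `ℚ`-semialgebraic `A, B` on `Δ` with a `C¹`
potential `S` of `A da + B db` on the open triangle, off a `ℚ`-semialgebraic null set `Z` the fibre
functions `b ↦ A(a,b)` and `a ↦ B(a,b)` are differentiable with THE SAME derivative
`h = ∂_b A = ∂_a B`: semialgebraic functions are smooth off a `ℚ`-semialgebraic set with empty
interior (`IsSemialgebraicFunOn.exists_contDiffOn_holds`, SemialgebraicMapsSmoothProofs.lean; empty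
interior ⇒ null via `volume_frontier_eq_zero_of_isSemialgebraic`), and where `A, B` are `C¹` the
potential `S` is `C²`, so Schwarz's theorem (`ContDiffAt.isSymmSndFDerivAt`) gives `∂_b A = ∂_a B`.
[size L] -/
theorem stub_mixedPartials : ∀ (A B S : (Fin 2 → ℝ) → ℝ),
    IsSemialgebraicFunOn ℚ {p : Fin 2 → ℝ | 0 ≤ p 0 ∧ 0 ≤ p 1 ∧ p 0 + p 1 ≤ 1} A →
    IsSemialgebraicFunOn ℚ {p : Fin 2 → ℝ | 0 ≤ p 0 ∧ 0 ≤ p 1 ∧ p 0 + p 1 ≤ 1} B →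
    (∀ p : Fin 2 → ℝ, 0 < p 0 → 0 < p 1 → p 0 + p 1 < 1 →
      HasFDerivAt S (A p • ContinuousLinearMap.proj (R := ℝ) (φ := fun _ : Fin 2 => ℝ) 0 +
        B p • ContinuousLinearMap.proj (R := ℝ) (φ := fun _ : Fin 2 => ℝ) 1) p) →
    ∃ Z : Set (Fin 2 → ℝ), IsSemialgebraic ℚ Z ∧ volume Z = 0 ∧
      ∀ p : Fin 2 → ℝ, 0 < p 0 → 0 < p 1 → p 0 + p 1 < 1 → p ∉ Z →
        HasDerivAt (fun s : ℝ => A ![p 0, s]) (deriv (fun s : ℝ => A ![p 0, s]) (p 1)) (p 1) ∧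
        HasDerivAt (fun s : ℝ => B ![s, p 1]) (deriv (fun s : ℝ => A ![p 0, s]) (p 1)) (p 0) := by
  sorry

/-- **Integrability of the bulk**: for `A` continuous and `ℚ`-semialgebraic on the closed triangle,
the vertical fibre derivative `∂_b A` (Mathlib's `deriv`, extended by `0`; `ℚ`-semialgebraic on `Δ` by
`stub_fibreDerivSemialgebraic`, taken here as a hypothesis) is absolutely integrable on `Δ`: on each
2-cell of a `ℚ`-cylindrical decomposition adapted to the sign sets of `∂_b A` and to the (null)
non-smooth locus of `A` (`IsSemialgebraicFunOn.exists_contDiffOn_holds`), `b ↦ A(a,b)` is monotone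
and `C¹` on the open fibres and continuous on the closed ones, so
`∫ |∂_b A(a,·)| = |A(a,β(a)) − A(a,α(a))| ≤ 2‖A‖_∞` (`MeasureTheory.integrableOn_deriv_of_nonneg`,
FTC), and Tonelli over the bounded base; null cells do not matter. [size L] -/
theorem stub_derivIntegrable : ∀ A : (Fin 2 → ℝ) → ℝ,
    IsSemialgebraicFunOn ℚ {p : Fin 2 → ℝ | 0 ≤ p 0 ∧ 0 ≤ p 1 ∧ p 0 + p 1 ≤ 1} A →
    ContinuousOn A {p : Fin 2 → ℝ | 0 ≤ p 0 ∧ 0 ≤ p 1 ∧ p 0 + p 1 ≤ 1} →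
    IsSemialgebraicFunOn ℚ {p : Fin 2 → ℝ | 0 ≤ p 0 ∧ 0 ≤ p 1 ∧ p 0 + p 1 ≤ 1}
      (fun p => if 0 < p 0 ∧ 0 < p 1 ∧ p 0 + p 1 < 1
        then deriv (fun s : ℝ => A ![p 0, s]) (p 1) else 0) →
    IntegrableOn (fun p => if 0 < p 0 ∧ 0 < p 1 ∧ p 0 + p 1 < 1
        then deriv (fun s : ℝ => A ![p 0, s]) (p 1) else 0)
      {p : Fin 2 → ℝ | 0 ≤ p 0 ∧ 0 ≤ p 1 ∧ p 0 + p 1 ≤ 1} volume := by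
  sorry

/-- **Green is three moves on the native band** (held by the lead; becomes sorry-free glue over the
five stubs above plus 1b-bookkeeping at the next reshape): every instance of the typed Green generator
of stmt-10042 lies in `KZ.relations`. [size L, composite] -/
theorem stub_greenInRelations : ∀ g ∈ greenSet, g ∈ KZ.relations := by
  sorry

/-! ## Composition (sorry-free): the stubs and `RealOnePeriodRelations` imply the crux -/

/-- `M₁ = closure (1a ∪ 1b ∪ 2 ∪ Green) ≤ relations`, from `stub_greenInRelations`. -/
theorem M₁_le_relations : M₁ ≤ KZ.relations := by
  refine (AddSubgroup.closure_le _).mpr ?_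
  rintro c (((hc | hc) | hc) | hc)
  · exact KZ.domainAddRel_subset_relations hc
  · exact KZ.integrandAddRel_subset_relations hc
  · exact KZ.changeOfVariablesRel_subset_relations hc
  · exact stub_greenInRelations c hc

/-- `eval` of a slicing: if `[r] − c ∈ relations` then `eval c = r.value` (soundness). -/
theorem eval_eq_value_of_sub_mem {r : KZ.IntegralRep 2} {c : KZ.FormalRep}
    (h : KZ.of r - c ∈ KZ.relations) : KZ.eval c = r.value := by
  have h0 := KZ.relations_le_ker_eval_holds h
  rw [AddMonoidHom.mem_ker, map_sub, KZ.eval_of, sub_eq_zero] at h0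
  exact h0.symm

/-- **The line's composition**: `RealOnePeriodRelations` (stmt-10042) implies the crux
`PlanarAreas` (stmt-4990). Slice both regions to `c, c' ∈ H₁` (`stub_areaSlicing`); by soundness
`eval (c − c') = r.value − r'.value = 0`; by `RealOnePeriodRelations`, `c − c' ∈ M₁`; and
`M₁ ≤ relations` (`stub_greenInRelations`). -/
theorem PlanarAreas_of
    (h : Summit.KontsevichZagierPeriods.KontsevichZagierPeriods.Theses.SymplecticScissors.RealOnePeriodRelations) :
    Summit.KontsevichZagierPeriods.KontsevichZagierPeriods.Theses.SymplecticScissors.PlanarAreas := by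
  intro r r' hr hr' hv
  obtain ⟨c, hc, hrc⟩ := stub_areaSlicing r hr
  obtain ⟨c', hc', hrc'⟩ := stub_areaSlicing r' hr'
  have hH : c - c' ∈ H₁ := H₁.sub_mem hc hc'
  have heval : KZ.eval (c - c') = 0 := by
    rw [map_sub, eval_eq_value_of_sub_mem hrc, eval_eq_value_of_sub_mem hrc', hv, sub_self]
  have hM : c - c' ∈ M₁ := (crux_iff.mp h) (c - c') hH heval
  have hsplit : KZ.of r - KZ.of r' = (KZ.of r - c) - (KZ.of r' - c') + (c - c') := by abel
  show KZ.of r - KZ.of r' ∈ KZ.relations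
  rw [hsplit]
  exact KZ.relations.add_mem (KZ.relations.sub_mem hrc hrc') (M₁_le_relations hM)

/-- The same composition for the verbatim copy of the crux in route LowDimension (r3). -/
theorem PlanarAreas_of_lowDimension
    (h : Summit.KontsevichZagierPeriods.KontsevichZagierPeriods.Theses.SymplecticScissors.RealOnePeriodRelations) :
    Summit.KontsevichZagierPeriods.KontsevichZagierPeriods.Theses.LowDimension.PlanarAreas :=
  PlanarAreas_of h

/-- The same composition for the verbatim copy of the crux in route HodgeLevel (r4). -/
theorem PlanarAreas_of_hodgeLevel
    (h : Summit.KontsevichZagierPeriods.KontsevichZagierPeriods.Theses.SymplecticScissors.RealOnePeriodRelations) :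
    Summit.KontsevichZagierPeriods.KontsevichZagierPeriods.Theses.HodgeLevel.PlanarAreas :=
  PlanarAreas_of h

end Summit.KontsevichZagierPeriods.SymplecticScissors.PlanarAreas

end
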